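import Summits.CriticalPhenomena.Ising3DConformalLimit.Theorems.EnergyNotSigmaSquaredMoebiusLimitExistsEquicontinuousTwo
import HarnessLib

/-!
# The pinned PAIR zoom converges under the two-point law
(line `Sketch` of the crux `ExistsScaleCovariantLimit`, item stmt-CriticalPhenomena-1981;
stub `stub_pairZoom_tendsto_of_twoPointLaw`, glue T2 of lead c4)

Under the rotation-invariant two-point power law `⟨σ₀σ_y⟩_{β_c}‖y‖₂^{2Δ} → c > 0` (`y → ∞`; the data
of item stmt-CriticalPhenomena-0634, passed as hypotheses), along every mesh sequence `u k → 0⁺` and at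
every non-coincident pair `x`, the PINNED pair zoom of the critical `ℤ³` Ising correlators
`rescaledCorrelator (criticalCorr 3) rhoPin 2 (u k) x = ρ_pin(u k)² ⟨σ_{[x₀/u k]} σ_{[x₁/u k]}⟩_{β_c}`,
`ρ_pin(δ) = ⟨σ₀σ_{⌊1/δ⌋e₀}⟩_{β_c}^{-1/2}`, converges to `‖x 0 − x 1‖^{-2Δ}`.

Mechanism. This is the singleton case `K = {x}` of crux 1344's landed and built
`MoebiusLimitExistsOnlyInteraction.tendstoUniformlyOn_rescaledCorrelator_two` (uniform convergence of
the pinned pair zoom to `x ↦ ‖x 1 − x 0‖^{-2Δ}` on compact sets of non-coincident pairs, module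
`…EnergyNotSigmaSquaredMoebiusLimitExistsEquicontinuousTwo`): `{x}` is compact
(`isCompact_singleton`) and contained in `NonCoincident 3 2`; uniform convergence on `{x}` gives
convergence at `x` (`TendstoUniformlyOn.tendsto_at`), and `‖x 1 − x 0‖ = ‖x 0 − x 1‖`
(`norm_sub_rev`). No named facts, no definitions. [folklore]
-/

noncomputable section

namespace Summit.CriticalPhenomena.Ising3DConformalLimit.Cruxes.ExistsScaleCovariantLimit.TwoHierarchies

open Literature.Probability.LatticeModels Filter Set
open scoped Topology
open Summit.CriticalPhenomena.Ising3DConformalLimit.MoebiusLimitExistsOnlyInteraction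
  (rhoPin tendstoUniformlyOn_rescaledCorrelator_two)

/-- **T2 — the pinned PAIR zoom converges under the two-point law.** If
`⟨σ₀σ_y⟩_{β_c}‖y‖₂^{2Δ} → c > 0` (`y → ∞` in `ℤ³`), then along every mesh sequence `u k → 0⁺` and
at every non-coincident pair `x`,
`ρ_pin(u k)² ⟨σ_{[x₀/u k]} σ_{[x₁/u k]}⟩_{β_c} → ‖x 0 − x 1‖^{-2Δ}` — the singleton case `K = {x}` of
`tendstoUniformlyOn_rescaledCorrelator_two` and `TendstoUniformlyOn.tendsto_at`, with
`‖x 1 − x 0‖ = ‖x 0 − x 1‖`. [folklore] -/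
theorem stub_pairZoom_tendsto_of_twoPointLaw :
    ∀ (Δ c : ℝ), 0 < c →
      Tendsto (fun y : Site 3 => criticalTwoPoint 3 y * Real.sqrt (∑ i, ((y i : ℝ)) ^ 2) ^ (2 * Δ))
        cofinite (𝓝 c) →
      ∀ u : ℕ → ℝ, Tendsto u atTop (𝓝[>] (0 : ℝ)) →
        ∀ x ∈ NonCoincident 3 2,
          Tendsto (fun k => rescaledCorrelator (criticalCorr 3) rhoPin 2 (u k) x) atTop
            (𝓝 (‖x 0 - x 1‖ ^ (-(2 * Δ)))) := by
  intro Δ c hc hG u hu x hx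
  -- uniform convergence on the compact singleton `{x} ⊆ NonCoincident 3 2`
  have hU := tendstoUniformlyOn_rescaledCorrelator_two (Δ := Δ) hc hG hu
    (isCompact_singleton (x := x)) (Set.singleton_subset_iff.2 hx)
  -- evaluate at `x ∈ {x}` and flip the difference inside the norm
  have h := hU.tendsto_at (Set.mem_singleton x)
  rw [norm_sub_rev] at h
  exact h

end Summit.CriticalPhenomena.Ising3DConformalLimit.Cruxes.ExistsScaleCovariantLimit.TwoHierarchies

end
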